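import Literature.NumberTheory.EllipticCurves.SerreOpenImageSupersingularParameterProofs
import HarnessLib

/-!
# Valuations of the `ℓ²`-torsion abscissae at a good supersingular prime (Serre 1972, §1.11, one
# level up)

Topic `NumberTheory/EllipticCurves`.  Theorems only (nothing is defined, no named fact).  Sequel
of `SerreOpenImageSupersingularValuationProofs` / `SerreOpenImageSupersingularParameterProofs`:
`E = W/ℚ` in global minimal form, `ℓ` an odd prime of good **supersingular** reduction
(`ℓ ∤ Δ_min`, `ℓ ∣ a_ℓ`), `v` the valuation of the place `placeOver ℓ` of `ℚ̄` (written
multiplicatively, `v(ℓ) < 1`), `d = (ℓ² - 1)/2`.  The cited file proves that the abscissa `x` of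
a nonzero point of `E[ℓ]` has `v(x) > 1` and `v(x)^d · v(ℓ) = 1` ("the points of order `ℓ` of a
formal group of height `2` over an absolutely unramified base have parameter of valuation
`1/(ℓ² - 1)`", J.-P. Serre, Invent. Math. 15 (1972), §1.11, Prop. 12 for `e = 1`; Prop. 10).
Here, ONE LEVEL HIGHER:

* `valuation_X_pow_mul_eq_one_of_sq_torsion` — **for a point `Q = (x, y) ∈ E(ℚ̄)` with `ℓ² Q = O`
  and `ℓ Q ≠ O` one has `v(x) > 1` and `v(x)^{ℓ² d} · v(ℓ) = 1`** (i.e. "the points of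
  `E[ℓ²] ∖ E[ℓ]` have parameter of valuation `1/(ℓ²(ℓ² - 1))`", the height-`2` Newton polygon of
  `[ℓ]` iterated once: Serre, loc. cit., §1.9–1.11; Silverman, *AEC*, IV.6.1, IV.7.2, VII.3).

Proof (elementary, no formal groups): write `P = ℓQ = (x', y')`, a nonzero point of `E[ℓ]`, so
`v(x') > 1`, `v(x')^d v(ℓ) = 1`.  The multiplication-by-`ℓ` formula `x' · ψ_ℓ(x)² = Φ_ℓ(x)`
(tree theorem `WeierstrassCurve.mul_eval_ΨSq_of_zsmul_eq`, Silverman *AEC* Ex. 3.7 (d)) is read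
with valuations: `Φ_ℓ ∈ ℤ[X]` is monic of degree `ℓ²` (Mathlib `natDegree_Φ`, `coeff_Φ`), so
`v(Φ_ℓ(x)) = v(x)^{ℓ²}` once `v(x) > 1`; and `ψ_ℓ = ℓ X^d + ℓ(…) + c₀` with `ℓ ∤ c₀` at a good
supersingular `ℓ` (tree theorems `dvd_coeff_preΨ'`, `not_dvd_coeff_preΨ'_zero`), so
`v(ψ_ℓ(x)) = 1` unless `v(ℓ) v(x)^d ≥ 1`, a case which the equation excludes
(`v(x) ≤ v(x') v(ℓ)² < 1`).  Hence `v(x') = v(x)^{ℓ²}`, and `v(x) > 1` because an integral `x`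
would make the right-hand side integral while `v(x' ψ_ℓ(x)²) = v(x') > 1`.

Use (cell `bsd-rank1-residual`, team n1011, sub-target T-b2): at `ℓ = 3` this is "`v(x(Q)) =
-1/36` for `Q ∈ E[9] ∖ E[3]`", the valuation input from which the inertia group at `3` is shown to
act on `E[9]` through a group of order divisible by `72`, whence the `3`-adic tower at a good
supersingular `3` (Wuthrich 2014, Lemma 20, supersingular case).

## References

* [Serre1972] J.-P. Serre, Invent. Math. 15 (1972) 259–331, §1.9–1.11 (Prop. 9, 10, 12).
* [SilvermanAEC2009] J. H. Silverman, *The Arithmetic of Elliptic Curves*, 2nd ed. (2009),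
  Exercise 3.7 (d), Thm. IV.6.1, IV.7.2, VII.§3.
-/

noncomputable section

open scoped Classical
open Polynomial WeierstrassCurve

namespace Literature.NumberTheory.EllipticCurves

variable (ℓ : ℕ) [Fact ℓ.Prime] {W : WeierstrassCurve ℚ} [W.IsGloballyMinimal]

omit [Fact ℓ.Prime] [W.IsGloballyMinimal] in
/-- The curve underlying `W.geomPoints` is the integral minimal model read in `ℚ̄`. [folklore] -/
private theorem baseChange_algClosure_eq_map_integralModelInt [W.IsGloballyMinimal] :
    @WeierstrassCurve.baseChange ℚ _ W (AlgebraicClosure ℚ) _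
        (@AlgebraicClosure.instAlgebra ℚ _ ℚ _ _) =
      (integralModelInt W).map (Int.castRingHom (AlgebraicClosure ℚ)) := by
  conv_lhs => rw [← map_integralModelInt W]
  rw [baseChange, WeierstrassCurve.map_map]
  exact congrArg (integralModelInt W).map (RingHom.ext_int _ _)

/-- Integers have valuation `≤ 1` at the place. [folklore] -/
private theorem valuation_placeOver_intCast_le_one (n : ℤ) :
    (placeOver ℓ).valuation (n : AlgebraicClosure ℚ) ≤ 1 := by
  rcases em ((ℓ : ℤ) ∣ n) with hn | hn
  · exact ((valuation_placeOver_intCast_lt_one_iff ℓ).mpr hn).le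
  · exact (valuation_placeOver_intCast_eq_one ℓ hn).le

/-- **A monic integral polynomial at a non-integral point is dominated by its top term**:
for `G ∈ ℤ[X]` monic of degree `N` (read in `ℚ̄`) and `v(x) > 1`, `v(G(x)) = v(x)^N`. [folklore] -/
private theorem valuation_eval_map_eq_pow_of_monic {G : ℤ[X]} (hG : G.Monic) {x : AlgebraicClosure ℚ}
    (hx : 1 < (placeOver ℓ).valuation x) :
    (placeOver ℓ).valuation ((G.map (Int.castRingHom (AlgebraicClosure ℚ))).eval x) =
      (placeOver ℓ).valuation x ^ G.natDegree := by
  set v := (placeOver ℓ).valuation with hv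
  set N := G.natDegree with hN
  set F := G.map (Int.castRingHom (AlgebraicClosure ℚ)) with hF
  have hdegF : F.natDegree = N := by
    rw [hF, natDegree_map_eq_of_injective (Int.castRingHom (AlgebraicClosure ℚ)).injective_int]
  have hcoeff : ∀ i, F.coeff i = ((G.coeff i : ℤ) : AlgebraicClosure ℚ) := fun i ↦ by
    rw [hF, coeff_map, eq_intCast]
  have htop : F.coeff N = 1 := by
    rw [hcoeff, hN, ← Polynomial.leadingCoeff, hG.leadingCoeff, Int.cast_one]
  have hxne : v x ≠ 0 := by rintro h; rw [h] at hx; exact not_lt_zero hx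
  have hsum : F.eval x = (∑ i ∈ Finset.range N, F.coeff i * x ^ i) + x ^ N := by
    rw [eval_eq_sum_range, hdegF, Finset.sum_range_succ, htop, one_mul]
  have hlow : v (∑ i ∈ Finset.range N, F.coeff i * x ^ i) < v x ^ N := by
    refine Valuation.map_sum_lt _ (pow_ne_zero _ hxne) fun i hi ↦ ?_
    rw [Finset.mem_range] at hi
    rw [map_mul, map_pow, hcoeff]
    calc v ((G.coeff i : ℤ) : AlgebraicClosure ℚ) * v x ^ i ≤ 1 * v x ^ i := by
          gcongr; exact valuation_placeOver_intCast_le_one ℓ _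
      _ = v x ^ i := one_mul _
      _ < v x ^ N := pow_lt_pow_right₀ hx hi
  rw [hsum, add_comm, Valuation.map_add_eq_of_lt_left _ (by rw [map_pow]; exact hlow), map_pow]

/-- An integral polynomial at an integral point is integral: `v(G(x)) ≤ 1` for `G ∈ ℤ[X]`,
`v(x) ≤ 1`. [folklore] -/
private theorem valuation_eval_map_le_one {G : ℤ[X]} {x : AlgebraicClosure ℚ}
    (hx : (placeOver ℓ).valuation x ≤ 1) :
    (placeOver ℓ).valuation ((G.map (Int.castRingHom (AlgebraicClosure ℚ))).eval x) ≤ 1 := by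
  set v := (placeOver ℓ).valuation with hv
  rw [eval_eq_sum_range]
  refine Valuation.map_sum_le _ fun i _ ↦ ?_
  rw [map_mul, map_pow, coeff_map, eq_intCast]
  calc v ((G.coeff i : ℤ) : AlgebraicClosure ℚ) * v x ^ i ≤ 1 * 1 := by
        gcongr
        · exact valuation_placeOver_intCast_le_one ℓ _
        · exact pow_le_one₀ zero_le hx
    _ = 1 := one_mul 1

/-- **The valuation of `ψ_ℓ` at a point** (good supersingular odd `ℓ`): for `x ∈ ℚ̄`, either
`v(x) ≤ 1` and then `v(ψ_ℓ(x)) = 1`, or `v(x) > 1` and then `v(ψ_ℓ(x)) = 1` if `v(ℓ) v(x)^d < 1`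
while `v(ψ_ℓ(x)) ≤ v(ℓ) v(x)^d` if `v(ℓ) v(x)^d ≥ 1` (`ψ_ℓ = ℓX^d + ℓ(…) + unit`).
[cite: Serre1972, §1.11 Prop. 12] -/
theorem valuation_eval_preΨ' [W.IsElliptic] (hΔ : ¬ (ℓ : ℤ) ∣ minimalDiscriminantInt W)
    (hss : (ℓ : ℤ) ∣ W.frobeniusTrace ℓ) (hℓ2 : ℓ ≠ 2) (x : AlgebraicClosure ℚ) :
    ((placeOver ℓ).valuation ℓ * (placeOver ℓ).valuation x ^ ((ℓ ^ 2 - 1) / 2) < 1 →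
        (placeOver ℓ).valuation
          ((((integralModelInt W).preΨ' ℓ).map (Int.castRingHom (AlgebraicClosure ℚ))).eval x) = 1) ∧
      (1 ≤ (placeOver ℓ).valuation ℓ * (placeOver ℓ).valuation x ^ ((ℓ ^ 2 - 1) / 2) →
        (placeOver ℓ).valuation
          ((((integralModelInt W).preΨ' ℓ).map (Int.castRingHom (AlgebraicClosure ℚ))).eval x) ≤
          (placeOver ℓ).valuation ℓ * (placeOver ℓ).valuation x ^ ((ℓ ^ 2 - 1) / 2)) := by
  have hp : ℓ.Prime := Fact.out
  set v := (placeOver ℓ).valuation with hv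
  set F := ((integralModelInt W).preΨ' ℓ).map (Int.castRingHom (AlgebraicClosure ℚ)) with hF
  set d := (ℓ ^ 2 - 1) / 2 with hd
  obtain ⟨hdeg, hlead⟩ := natDegree_preΨ'_map_eq ℓ (W := W) hℓ2
  have hdegF : F.natDegree = d := by rw [hF, hd]; exact hdeg
  have hd1 : 1 ≤ d := by
    have h3 : 3 ≤ ℓ := by have := hp.two_le; omega
    have : 8 ≤ ℓ ^ 2 - 1 := by
      have : 9 ≤ ℓ ^ 2 := by nlinarith
      omega
    rw [hd]; omega
  have hvℓ : v ℓ < 1 := valuation_placeOver_natCast_lt_one ℓ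
  have hcoeff : ∀ i, F.coeff i = (((integralModelInt W).preΨ' ℓ).coeff i : AlgebraicClosure ℚ) :=
    fun i ↦ by rw [hF, coeff_map, eq_intCast]
  have hvi : ∀ i, i ≠ 0 → v (F.coeff i) ≤ v ℓ := by
    intro i hi
    obtain ⟨m, hm⟩ := dvd_coeff_preΨ' ℓ hΔ hss hi
    rw [hcoeff, hm, Int.cast_mul, Int.cast_natCast, map_mul]
    conv_rhs => rw [← mul_one (v ℓ)]
    gcongr
    exact valuation_placeOver_intCast_le_one ℓ _
  have hv0 : v (F.coeff 0) = 1 := by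
    rw [hcoeff]
    exact valuation_placeOver_intCast_eq_one ℓ (not_dvd_coeff_preΨ'_zero ℓ hΔ hss)
  have hvd : v (F.coeff d) = v ℓ := by rw [hlead]
  -- `F(x) = c₀ + (middle + c_d x^d)`
  obtain ⟨d', hd'⟩ : ∃ d', d = d' + 1 := ⟨d - 1, by omega⟩
  have hsplit : F.eval x =
      F.coeff 0 + ((∑ i ∈ Finset.range d', F.coeff (i + 1) * x ^ (i + 1)) + F.coeff d * x ^ d) := by
    rw [eval_eq_sum_range, hdegF, Finset.sum_range_succ, hd', Finset.sum_range_succ', pow_zero,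
      mul_one, ← hd']
    ring
  -- the middle terms and the top term are all `≤ v(ℓ) · max(1, v(x)^d)`-ish; two regimes
  by_cases hx1 : v x ≤ 1
  · -- integral `x`: everything after `c₀` is `< 1`
    have hR : v ((∑ i ∈ Finset.range d', F.coeff (i + 1) * x ^ (i + 1)) + F.coeff d * x ^ d) < 1 := by
      refine Valuation.map_add_lt _ (Valuation.map_sum_lt _ one_ne_zero fun i _ ↦ ?_) ?_
      · rw [map_mul, map_pow]
        calc v (F.coeff (i + 1)) * v x ^ (i + 1) ≤ v ℓ * 1 := by
              gcongr
              · exact hvi _ i.succ_ne_zero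
              · exact pow_le_one₀ zero_le hx1
          _ < 1 := by rwa [mul_one]
      · rw [map_mul, map_pow, hvd]
        calc v ℓ * v x ^ d ≤ v ℓ * 1 := by gcongr; exact pow_le_one₀ zero_le hx1
          _ < 1 := by rwa [mul_one]
    have hFx : v (F.eval x) = 1 := by
      rw [hsplit, Valuation.map_add_eq_of_lt_left _ (by rwa [hv0]), hv0]
    refine ⟨fun _ ↦ hFx, fun h1 ↦ ?_⟩
    -- this regime is incompatible with `1 ≤ v(ℓ) v(x)^d` (which forces `v x > 1`), but the bound holds anyway
    exfalso
    have : v ℓ * v x ^ d < 1 := by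
      calc v ℓ * v x ^ d ≤ v ℓ * 1 := by gcongr; exact pow_le_one₀ zero_le hx1
        _ < 1 := by rwa [mul_one]
    exact absurd h1 (not_le.mpr this)
  · rw [not_le] at hx1
    have hxne : v x ≠ 0 := by rintro h; rw [h] at hx1; exact not_lt_zero hx1
    have hvℓ0 : v ℓ ≠ 0 := by
      rw [hv, Valuation.ne_zero_iff]; exact_mod_cast hp.ne_zero
    -- the middle terms are dominated by `c_d x^d`
    have hdom : v (∑ i ∈ Finset.range d', F.coeff (i + 1) * x ^ (i + 1)) < v (F.coeff d * x ^ d) := by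
      rw [map_mul, map_pow, hvd]
      refine Valuation.map_sum_lt _ (mul_ne_zero hvℓ0 (pow_ne_zero _ hxne)) fun i hi ↦ ?_
      rw [Finset.mem_range] at hi
      rw [map_mul, map_pow]
      calc v (F.coeff (i + 1)) * v x ^ (i + 1) ≤ v ℓ * v x ^ (i + 1) := by
            gcongr; exact hvi _ i.succ_ne_zero
        _ < v ℓ * v x ^ d := mul_lt_mul_left_of_ne_zero hvℓ0 (pow_lt_pow_right₀ hx1 (by omega))
    have hR : v ((∑ i ∈ Finset.range d', F.coeff (i + 1) * x ^ (i + 1)) + F.coeff d * x ^ d) =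
        v ℓ * v x ^ d := by
      rw [add_comm, Valuation.map_add_eq_of_lt_left _ hdom, map_mul, map_pow, hvd]
    refine ⟨fun hlt ↦ ?_, fun hge ↦ ?_⟩
    · rw [hsplit, Valuation.map_add_eq_of_lt_left _ (by rw [hR, hv0]; exact hlt), hv0]
    · rw [hsplit]
      refine (Valuation.map_add_le _ ?_ (le_of_eq hR))
      rw [hv0]; exact hge

/-- **Valuation of the abscissae of `E[ℓ²] ∖ E[ℓ]` at a good supersingular odd prime `ℓ`**: for
`Q = (x, y) ∈ E(ℚ̄)` with `ℓ² Q = O` and `ℓ Q ≠ O` one has `v(x) > 1` and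
`v(x)^{ℓ²·d} · v(ℓ) = 1`, `d = (ℓ² - 1)/2` — the level-`ℓ²` companion of
`valuation_pow_mul_eq_one_of_isRoot` (level `ℓ`: `v(x)^d v(ℓ) = 1`).  Serre 1972, §1.9–1.11:
a formal group of height `2` over an absolutely unramified base has its points of exact order
`ℓ²` at "level `1/(ℓ²(ℓ² - 1))`"; here read off the multiplication-by-`ℓ` formula
`x(ℓQ) ψ_ℓ(x)² = Φ_ℓ(x)`. [cite: Serre1972, §1.11 Prop. 12 (e = 1) with §1.9–1.10]
[cite: SilvermanAEC2009, Exercise 3.7 (d)] -/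
theorem valuation_X_pow_mul_eq_one_of_sq_torsion [W.IsElliptic] (hΔ : ¬ (ℓ : ℤ) ∣ minimalDiscriminantInt W)
    (hss : (ℓ : ℤ) ∣ W.frobeniusTrace ℓ) (hℓ2 : ℓ ≠ 2) {Q : W.geomPoints}
    (hQ : (ℓ : ℤ) • ((ℓ : ℤ) • Q) = 0) (hQℓ : (ℓ : ℤ) • Q ≠ 0)
    {x y : AlgebraicClosure ℚ} {h} (hQxy : Q = .some x y h) :
    1 < (placeOver ℓ).valuation x ∧
      (placeOver ℓ).valuation x ^ (ℓ ^ 2 * ((ℓ ^ 2 - 1) / 2)) * (placeOver ℓ).valuation ℓ = 1 := by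
  have hp : ℓ.Prime := Fact.out
  set v := (placeOver ℓ).valuation with hv
  set d := (ℓ ^ 2 - 1) / 2 with hd
  have hvℓ : v ℓ < 1 := valuation_placeOver_natCast_lt_one ℓ
  have hvℓ0 : v ℓ ≠ 0 := by
    rw [hv, Valuation.ne_zero_iff]; exact_mod_cast hp.ne_zero
  have hd1 : 1 ≤ d := by
    have h3 : 3 ≤ ℓ := by have := hp.two_le; omega
    have : 8 ≤ ℓ ^ 2 - 1 := by
      have : 9 ≤ ℓ ^ 2 := by nlinarith
      omega
    rw [hd]; omega
  have h2d : 2 * d = ℓ ^ 2 - 1 := by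
    have hodd : Odd ℓ := hp.odd_of_ne_two hℓ2
    have heven : Even (ℓ ^ 2 - 1) := by
      rcases hodd with ⟨k, hk⟩
      refine ⟨2 * k ^ 2 + 2 * k, ?_⟩
      rw [hk]; ring_nf; omega
    rw [hd]; exact Nat.two_mul_div_two_of_even heven
  have hℓsq : ℓ ^ 2 = 2 * d + 1 := by
    have : 1 ≤ ℓ ^ 2 := Nat.one_le_pow _ _ hp.pos
    omega
  -- the point `P = ℓ Q ∈ E[ℓ] ∖ 0` and its abscissa `x'`
  obtain ⟨x', y', h', hPxy⟩ := geomPoints.exists_eq_some (P := (ℓ : ℤ) • Q) hQℓ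
  obtain ⟨hx'1, hx'd⟩ := valuation_pow_mul_eq_one_of_isRoot ℓ hΔ hss hℓ2
    (isRoot_preΨ'_of_zsmul_eq_zero ℓ hℓ2 hQ hPxy)
  -- the multiplication-by-`ℓ` formula `x' ψ_ℓ(x)² = Φ_ℓ(x)`
  set F := ((integralModelInt W).preΨ' ℓ).map (Int.castRingHom (AlgebraicClosure ℚ)) with hF
  set G := ((integralModelInt W).Φ ℓ).map (Int.castRingHom (AlgebraicClosure ℚ)) with hG
  have hodd : ¬ Even ℓ := fun he ↦ hℓ2 ((hp.even_iff).mp he)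
  have hmul : x' * (F.eval x) ^ 2 = G.eval x := by
    subst hQxy
    have key := mul_eval_ΨSq_of_zsmul_eq _ h (ℓ : ℤ) h' hPxy
    rw [baseChange_algClosure_eq_map_integralModelInt, map_ΨSq, map_Φ, eval_map, eval_map,
      ΨSq_ofNat, if_neg hodd, mul_one, eval₂_pow] at key
    rw [hF, hG, eval_map, eval_map]
    exact_mod_cast key
  -- `Φ_ℓ` is monic of degree `ℓ²` over `ℤ`
  have hGmonic : ((integralModelInt W).Φ ℓ).Monic := by
    rw [Monic, leadingCoeff_Φ]
  have hGdeg : ((integralModelInt W).Φ ℓ).natDegree = ℓ ^ 2 := by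
    rw [natDegree_Φ]; simp
  -- Step 1: `v x > 1`
  have hx1 : 1 < v x := by
    by_contra hle
    rw [not_lt] at hle
    have hGx : v (G.eval x) ≤ 1 := valuation_eval_map_le_one ℓ hle
    have hFx : v (F.eval x) = 1 := by
      refine (valuation_eval_preΨ' ℓ hΔ hss hℓ2 x).1 ?_
      calc v ℓ * v x ^ d ≤ v ℓ * 1 := by gcongr; exact pow_le_one₀ zero_le hle
        _ < 1 := by rwa [mul_one]
    have : v (G.eval x) = v x' := by rw [← hmul, map_mul, map_pow, hFx, one_pow, mul_one]
    rw [this] at hGx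
    exact absurd hGx (not_le.mpr hx'1)
  refine ⟨hx1, ?_⟩
  have hxne : v x ≠ 0 := by rintro h0; rw [h0] at hx1; exact not_lt_zero hx1
  have hGx : v (G.eval x) = v x ^ ℓ ^ 2 := by
    rw [hG, valuation_eval_map_eq_pow_of_monic ℓ hGmonic hx1, hGdeg]
  -- Step 2: the regime `v(ℓ) v(x)^d ≥ 1` is impossible
  rcases lt_or_ge (v ℓ * v x ^ d) 1 with hlt | hge
  · -- `v(ψ_ℓ(x)) = 1`, so `v(x') = v(x)^{ℓ²}`
    have hFx : v (F.eval x) = 1 := (valuation_eval_preΨ' ℓ hΔ hss hℓ2 x).1 hlt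
    have hxx' : v x' = v x ^ ℓ ^ 2 := by
      rw [← hGx, ← hmul, map_mul, map_pow, hFx, one_pow, mul_one]
    calc v x ^ (ℓ ^ 2 * d) * v ℓ = (v x ^ ℓ ^ 2) ^ d * v ℓ := by rw [pow_mul]
      _ = v x' ^ d * v ℓ := by rw [hxx']
      _ = 1 := hx'd
  · exfalso
    have hFx : v (F.eval x) ≤ v ℓ * v x ^ d := (valuation_eval_preΨ' ℓ hΔ hss hℓ2 x).2 hge
    -- `v(x)^{ℓ²} = v(x') v(ψ(x))² ≤ v(x') v(ℓ)² v(x)^{2d}`, i.e. `v(x) ≤ v(x') v(ℓ)²`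
    have h1 : v x ^ ℓ ^ 2 ≤ v x' * (v ℓ * v x ^ d) ^ 2 := by
      rw [← hGx, ← hmul, map_mul, map_pow]
      exact mul_le_mul_right (pow_le_pow_left₀ zero_le hFx 2) _
    have h2 : v x * v x ^ (2 * d) ≤ (v x' * v ℓ ^ 2) * v x ^ (2 * d) := by
      calc v x * v x ^ (2 * d) = v x ^ ℓ ^ 2 := by rw [hℓsq, pow_succ, mul_comm]
        _ ≤ v x' * (v ℓ * v x ^ d) ^ 2 := h1
        _ = (v x' * v ℓ ^ 2) * v x ^ (2 * d) := by rw [mul_pow, ← pow_mul, mul_comm d 2, mul_assoc]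
    have h3 : v x ≤ v x' * v ℓ ^ 2 := le_of_mul_le_mul_right h2 (pow_pos (zero_lt_iff.mpr hxne) _)
    -- raise to the `d`-th power and use `v(x')^d v(ℓ) = 1`
    have h4 : v x ^ d ≤ v ℓ ^ (2 * d - 1) := by
      calc v x ^ d ≤ (v x' * v ℓ ^ 2) ^ d := pow_le_pow_left₀ zero_le h3 d
        _ = (v x' ^ d * v ℓ) * v ℓ ^ (2 * d - 1) := by
            rw [mul_pow, ← pow_mul, mul_assoc, ← pow_succ']
            congr 2
            omega
        _ = v ℓ ^ (2 * d - 1) := by rw [hx'd, one_mul]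
    have h5 : v ℓ ^ (2 * d - 1) < 1 := pow_lt_one₀ zero_le hvℓ (by omega)
    have h6 : 1 < v x ^ d := one_lt_pow₀ hx1 (by omega)
    exact absurd (h6.trans_le (h4.trans h5.le)) (lt_irrefl 1)

end Literature.NumberTheory.EllipticCurves

end
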